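import Literature.AlgebraicGeometry.Motives.GaloisThickening   -- ★ `thickening`, `thickeningLift`, `thickeningLift_left_comp_fst∕_snd`
import HarnessLib

/-!
# The sheet sections `ℓ_e` of the Galois thickening move along a homomorphism of coefficient fields: `ℓ_{φ∘e}(φ_* y) = Spec φ ≫ ℓ_e(y)`

Topic `AlgebraicGeometry/Motives`; namespace `Literature.AlgebraicGeometry.Motives`.  THEOREMS ONLY (no definition, no named fact, no instance, no notation, no
`sorry`); universe-polymorphic.  Cell `hodgecm-mathlib` (D-0151), P6 «MOD programme» (crux hLiu418 = stmt-HodgeConjecture-24832, `--supports`, count-neutral), line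
«L4», X-LEAF `Lines/F0_P6a_EExports.lean` (A-p01 (g28)) socket `stub_ECtoΩ` «transport of the E-readings from `ℂ`-points to `F̄_w`-points along a ring
isomorphism `σ : F̄_w ≃ ℂ` over `ι₁`» (LA4-plan (g0) DEAL #20′ (ii-c)): the readings sit at the SHEET POINTS `ℓ_{e′} y` (★ `thickeningLift`) of the thickening
`(C ⊗_F Fᵢ)|_F`; this file identifies the sheet point of the `σ`-moved pair `(σ ∘ e′, Spec σ ≫ y)` with `Spec σ ≫ ℓ_{e′} y` ON THE NOSE (underlying scheme
morphisms), so that the fibre of a tuple over `X ⊗_F Fᵢ` at the moved point is LITERALLY its base change along `Spec σ ≫ ℓ_{e′} y` (then ★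
`tupleRel_baseChangeCompGrpIso_hom∕_inv` + ★ `RoofBaseChangeAlongBaseIso` apply).  HC_CM is proved only modulo the 2 remaining named inputs (hLiu418 24832,
h413 24833) until rung 0 closes; nothing here is about HC.

THE MATHEMATICS ([GortzWedhorn2020] §(4.8)–(4.9)): for `K`-algebra maps `e : L → Ω`, `φ : Ω → Ω′` of fields and an `Ω`-point `y` of a `K`-scheme `X`, the
`Ω′`-point `φ_* y := Spec φ ≫ y` has sheet point `ℓ_{φ∘e}(φ_* y) = (φ_* y, Spec (φ ∘ e)) = Spec φ ≫ (y, Spec e) = Spec φ ≫ ℓ_e(y)` in `X ×_K Spec L`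
(both coordinates agree: `Spec (φ ∘ e) = Spec φ ≫ Spec e`).

* `thickeningLift_left_eq_comp_of_left_eq` — THE HEAD (the moved point given BY VALUE with its underlying morphism `= Spec φ ≫ y`);
* `specMap_comp_algPoints_hom` — the structure square making `Spec φ ≫ y` an `Ω′`-point (for consumers who build it with `AlgPoints.mk`).
* §2 (ED. 2) ALONG AN ISOMORPHISM `φ : Ω ≃ₐ[K] Ω′` of coefficient fields, read BACKWARDS: `specMap_algEquiv_symm_comp_specMap` (`Spec φ⁻¹ ≫ Spec φ = 𝟙`),
  `isIso_specMap_algEquiv_symm`, `thickeningLift_left_eq_specMap_symm_comp_of_left_eq` ∕ `…_mk` (`ℓ_e(y) = Spec φ⁻¹ ≫ ℓ_{φ∘e}(φ_* y)` — the form in which a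
  reading at the `Ω′`-points `φ_* y` is pulled back to the `Ω`-points `y` along the ISOMORPHISM `Spec φ⁻¹ : Spec Ω ⟶ Spec Ω′`; always `φ.toAlgHom`, never the
  coercion `(φ : Ω →ₐ[K] Ω′)`, whose class search is prohibitively slow at `Ω = F̄_w`).

## References
* [GortzWedhorn2020] U. Görtz, T. Wedhorn, *Algebraic Geometry I*, 2nd ed. (2020), §(4.8)–(4.9) (base change, points with values in field extensions).
* [Hartshorne1977] R. Hartshorne, *Algebraic Geometry* (1977), Ch. II Ex. 2.7 (field-valued points).
-/

set_option autoImplicit false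

noncomputable section

open CategoryTheory AlgebraicGeometry Limits

universe u

namespace Literature.AlgebraicGeometry.Motives

variable {K L : Type u} [Field K] [Field L] [Algebra K L] {Ω Ω' : Type u} [Field Ω] [Algebra K Ω] [Field Ω'] [Algebra K Ω']

/-- The structure square of the moved point: `(Spec φ ≫ y) ≫ (X → Spec K) = (Spec Ω′ → Spec K)` for a `K`-algebra map `φ : Ω → Ω′` — so
`AlgPoints.mk (Spec φ ≫ y.left) (specMap_comp_algPoints_hom φ y)` is the `Ω′`-point `φ_* y`. [cite: GortzWedhorn2020, Section (4.8)–(4.9)] -/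
theorem specMap_comp_algPoints_hom (φ : Ω →ₐ[K] Ω') (X : SchemeOver K) (y : AlgPoints X Ω) :
    (Spec.map (CommRingCat.ofHom φ.toRingHom) ≫ y.left) ≫ X.hom = Spec.map (CommRingCat.ofHom (algebraMap K Ω')) := by
  have hy : y.left ≫ X.hom = Spec.map (CommRingCat.ofHom (algebraMap K Ω)) := Over.w y
  rw [Category.assoc]
  erw [hy]
  rw [← Spec.map_comp, ← CommRingCat.ofHom_comp]
  congr 2
  ext x
  exact φ.commutes x

/-- **THE HEAD — SHEET POINTS MOVE ALONG A HOMOMORPHISM OF COEFFICIENT FIELDS.**  For `K`-algebra maps `e : L →ₐ[K] Ω`, `φ : Ω →ₐ[K] Ω′` and `Ω`-, `Ω′`-points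
`y`, `y′` of `X` with `y′ = Spec φ ≫ y` (underlying morphisms): `(ℓ_{φ∘e} y′) = Spec φ ≫ (ℓ_e y)` as morphisms `Spec Ω′ → X ×_K Spec L`.  With `φ := σ : F̄_w ≃ ℂ`
over `F` (★ `AdicCompletionAlgClosureEquivComplex`) this says: the COMPLEX sheet point over `(σ ∘ e′, σ_* y_w)` is `Spec σ` after the `F̄_w`-sheet point
`ℓ_{e′} y_w`. [cite: GortzWedhorn2020, Section (4.8)–(4.9)] [cite: Hartshorne1977, Ch. II Ex. 2.7] -/
theorem thickeningLift_left_eq_comp_of_left_eq (e : L →ₐ[K] Ω) (φ : Ω →ₐ[K] Ω') (X : SchemeOver K) (y : AlgPoints X Ω)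
    (y' : AlgPoints X Ω') (hy' : y'.left = Spec.map (CommRingCat.ofHom φ.toRingHom) ≫ y.left) :
    (thickeningLift (φ.comp e) X y').left = Spec.map (CommRingCat.ofHom φ.toRingHom) ≫ (thickeningLift e X y).left := by
  rw [thickeningLift_left, thickeningLift_left]
  apply pullback.hom_ext
  · erw [pullback.lift_fst, Category.assoc, pullback.lift_fst]
    exact hy'
  · erw [pullback.lift_snd, Category.assoc, pullback.lift_snd, ← Spec.map_comp, ← CommRingCat.ofHom_comp]
    rfl

/-- The same with the moved point BUILT here (`φ_* y := (Spec φ ≫ y, ·)`). [cite: GortzWedhorn2020, Section (4.8)–(4.9)] -/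
theorem thickeningLift_mk_specMap_comp_left (e : L →ₐ[K] Ω) (φ : Ω →ₐ[K] Ω') (X : SchemeOver K) (y : AlgPoints X Ω) :
    (thickeningLift (φ.comp e) X
        (AlgPoints.mk (Spec.map (CommRingCat.ofHom φ.toRingHom) ≫ y.left) (specMap_comp_algPoints_hom φ X y))).left =
      Spec.map (CommRingCat.ofHom φ.toRingHom) ≫ (thickeningLift e X y).left :=
  thickeningLift_left_eq_comp_of_left_eq e φ X y _ rfl

/-! ### §2 (ED. 2) Along an isomorphism of coefficient fields, read backwards: `ℓ_e(y) = Spec φ⁻¹ ≫ ℓ_{φ∘e}(φ_* y)` -/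

/-- `Spec φ⁻¹ ≫ Spec φ = 𝟙 (Spec Ω)` for a `K`-algebra isomorphism `φ : Ω ≃ₐ[K] Ω′` (`φ⁻¹ ∘ φ = id`). [cite: GortzWedhorn2020, Section (4.8)–(4.9)] -/
theorem specMap_algEquiv_symm_comp_specMap (φ : Ω ≃ₐ[K] Ω') :
    Spec.map (CommRingCat.ofHom φ.symm.toAlgHom.toRingHom) ≫ Spec.map (CommRingCat.ofHom φ.toAlgHom.toRingHom) = 𝟙 _ := by
  rw [← Spec.map_comp, ← CommRingCat.ofHom_comp]
  have h : φ.symm.toAlgHom.toRingHom.comp φ.toAlgHom.toRingHom = RingHom.id Ω := RingHom.ext fun a => φ.symm_apply_apply a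
  rw [h, CommRingCat.ofHom_id, Spec.map_id]

/-- `Spec φ⁻¹ : Spec Ω ⟶ Spec Ω′` is an isomorphism (inverse `Spec φ`). [cite: GortzWedhorn2020, Section (4.8)–(4.9)] -/
theorem isIso_specMap_algEquiv_symm (φ : Ω ≃ₐ[K] Ω') : IsIso (Spec.map (CommRingCat.ofHom φ.symm.toAlgHom.toRingHom)) :=
  ⟨⟨Spec.map (CommRingCat.ofHom φ.toAlgHom.toRingHom), specMap_algEquiv_symm_comp_specMap φ, by
    simpa only [AlgEquiv.symm_symm] using specMap_algEquiv_symm_comp_specMap φ.symm⟩⟩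

/-- **ALONG AN ISOMORPHISM, BACKWARDS.**  For `e : L →ₐ[K] Ω`, an isomorphism `φ : Ω ≃ₐ[K] Ω′` and points `y`, `y′` with `y′ = Spec φ ≫ y`:
`ℓ_e(y) = Spec φ⁻¹ ≫ ℓ_{φ∘e}(y′)` — §1 composed with `Spec φ⁻¹ ≫ Spec φ = 𝟙`.  With `φ := σ : F̄_w ≃ₐ[F] ℂ`: a reading of a family at the COMPLEX sheet points
`ℓ_{σ∘e′}(σ_* y)` is a reading at `x ≫ ℓ` with `x := Spec σ⁻¹` an isomorphism and `ℓ_{e′}(y) = x ≫ ℓ_{σ∘e′}(σ_* y)`, the input shape of ★ `roof_readAt_comp`.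
[cite: GortzWedhorn2020, Section (4.8)–(4.9)] [cite: Hartshorne1977, Ch. II Ex. 2.7] -/
theorem thickeningLift_left_eq_specMap_symm_comp_of_left_eq (e : L →ₐ[K] Ω) (φ : Ω ≃ₐ[K] Ω') (X : SchemeOver K) (y : AlgPoints X Ω)
    (y' : AlgPoints X Ω') (hy' : y'.left = Spec.map (CommRingCat.ofHom φ.toAlgHom.toRingHom) ≫ y.left) :
    (thickeningLift e X y).left =
      Spec.map (CommRingCat.ofHom φ.symm.toAlgHom.toRingHom) ≫ (thickeningLift (φ.toAlgHom.comp e) X y').left := by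
  rw [thickeningLift_left_eq_comp_of_left_eq e φ.toAlgHom X y y' hy', ← Category.assoc, specMap_algEquiv_symm_comp_specMap,
    Category.id_comp]

/-- The same with the moved point BUILT here (`φ_* y := (Spec φ ≫ y, ·)`). [cite: GortzWedhorn2020, Section (4.8)–(4.9)] -/
theorem thickeningLift_left_eq_specMap_symm_comp_mk (e : L →ₐ[K] Ω) (φ : Ω ≃ₐ[K] Ω') (X : SchemeOver K) (y : AlgPoints X Ω) :
    (thickeningLift e X y).left =
      Spec.map (CommRingCat.ofHom φ.symm.toAlgHom.toRingHom) ≫ (thickeningLift (φ.toAlgHom.comp e) X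
        (AlgPoints.mk (Spec.map (CommRingCat.ofHom φ.toAlgHom.toRingHom) ≫ y.left) (specMap_comp_algPoints_hom φ.toAlgHom X y))).left :=
  thickeningLift_left_eq_specMap_symm_comp_of_left_eq e φ X y _ rfl

end Literature.AlgebraicGeometry.Motives

end
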